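import Summits.QuantumFields.YangMills.Theorems.UnitScaleTiltProp7CurvedLandauCoreFinalT3
import HarnessLib

/-!
# Route `UnitScaleTilt`, crux K1 «MinimiserStabilityRegPr» (stmt-QuantumFields-19200), route-R [RP] curved — THE FIBRE CORE'S RESIDUAL (B7) AT d = 3, `SU(2)`, LETTERS:
# the scalar numerals (`ρ²L = 1`, `C_CM ≤ 25L²`, `C₁ ≤ 30L³`, `K₀ ≤ 132L²`, `ρ³/(1−ρ⁴) ≤ (7/10)L⁻¹`, `E_j ≤ 3/2`, the (B6)-shape coefficient, the end-game) and
# ★routeR-w2's `(H¹)^*` ROW READ AT EVERY LEVEL: `Σ_y‖Λ_i(y)‖² ≤ Lⁱ·(200L⁴(CURL+DIV) + 4·10⁹L⁹εℓ⁻²Σ‖Y‖²)` (`i ≤ K − n`) — the inputs of the sequel ✓ `…FibreLevelMassT3`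

Cell `ym3-torus`, D-0154 (3c) twin-width seat `ym-routeR-w3` (gen 2).  THEOREMS ONLY (0 `def`, 0 `sorry`); `--supports stmt-QuantumFields-19200`, count-neutral.  YM₃ on T³ is a
ladder rung (R3), not the Clay problem; nothing here claims the stub, the crux, d = 4 or the mass gap.

THE POINT.  The sequel closes the triangular system of ✓ `Prop7FibreLevelMass.sqrt_sum_normSq_levelRatio_le` with the scalar induction ✓ `Prop7FibreLevelMassInduction.
levelMass_induction` (`ρ = √((L^d)⁻¹L²) = L^{−1/2}`, `E = 3/2`, `D = 2√3`, `C = C_CM(a′ = 4ε)`, `C₁ = (d+2)L√((2dL^d)(2d))`).  This file supplies, ONCE and in a small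
context, every scalar fact the knit needs (§1) and the coarse-gauge input `ρⁱ‖Λ_i‖_{ℓ²} ≤ B` at every level (§2): ★routeR-w2's ✓ `Prop7CovIterLambdaHLambdaCurl.
sum_normSq_covIterLambda_le_curl_T3_su2` is stated at the run's top level `K − n` with the plaquette hypothesis at scale `L^{K−n}`; read at the run `n′ := K − i` with
`ε′ := ε·L^{2i}·ℓ⁻²` (the SAME hypothesis `dist1(U₀(∂p)) ≤ εℓ⁻² = ε′(Lⁱ)⁻²`, and `ε′ ≤ ε`) its mass term `10⁹·4·L⁹·ε′·(Lⁱ)⁻²` equals `4·10⁹L⁹εℓ⁻²` — i-INDEPENDENT.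

WHAT IS PROVED (ns `…Theorems.Prop7FibreLevelMassT3Letters`).
* §1 `rho_facts`, `two_sqrt_d_facts`, `ccm_le`, `c1_le`, `K0_nonneg`, `K0_le`, `q_le`, `theta_smallness`, `coeff_of_B6`, `level_exp_le`, `rho_pow_mul_sqrt_le`,
  `sq_le_of_rho_pow_mul_le`, `endgame`.
* §2 ★ `sum_normSq_covIterLambda_le_level` — (R-B) at every level `i ≤ K − n` (generic `Y`).
HONEST SCOPE.  Numerals and one re-reading of a landed theorem; nothing of print is asserted beyond the cited tree theorems.

References: T. Bałaban, CMP 99 (1985) 389–434 [Balaban1985BackgroundPropagators] (Thm 3.11 p.416); CMP 95 (1984) 17–40 [Balaban1984PropagatorsI] ((1.18)–(1.20) pp.19–20);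
CMP 98 (1985) 17–51 [Balaban1985Averaging] (Prop. 3 (124)–(126) p.36); CMP 102 (1985) 277–309 [Balaban1985Variational] ((14)–(15) p.280).
-/

set_option autoImplicit false

noncomputable section

open scoped BigOperators Matrix.Norms.L2Operator Matrix

namespace Summit.QuantumFields.YangMills.Theorems.Prop7FibreLevelMassT3Letters

open Literature.MathematicalPhysics.QuantumFieldTheory.Balaban1983to89
open Literature.MathematicalPhysics.QuantumFieldTheory.Balaban1983to89.T3ContinuumYM3Torus
open Finset T4Continuum T4ReflectionCone BlockAveraging AveragingRT ExpMeanLog BlockAveragingEMLLinearised BlockAveragingEMLLinearisedBackground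
  BlockAveragingEMLProp2 B1RG242Torus
open B9Eq39Adjoint (curl divB)
open B10Eq27TorusAxialLog (holT unitsField toUField)
open B9TorusCalculus (torusT)
open Summit.QuantumFields.YangMills.Theorems.Prop7CurvedLandauKnitT3 (smallness_T3 three_le_L)
open Summit.QuantumFields.YangMills.Theorems.Prop7CurvedLandauRowE (loop_size_geom size_numerals kappa_eq_mul_rho sum_range_pow_div_le_third exp_third_le)
open Summit.QuantumFields.YangMills.Theorems.Prop7CovIterLambdaBound (tower_plaq_lt plaqSmall_of_le_of_lt)
open Summit.QuantumFields.YangMills.Theorems.Prop7CovIterLambdaHLambdaCurl (sum_normSq_covIterLambda_le_curl_T3_su2)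

/-! ## §1 Scalar letters at d = 3 -/

/-- `ρ = √((L^d)⁻¹L²)` at d = 3: `0 < ρ < 1`, `ρ ≤ 3/5`, `ρ²·L = 1`. [folklore] -/
theorem rho_facts (F : T3Family) (K : ℕ) :
    0 < Real.sqrt (((((F.P K).L : ℝ)) ^ (F.P K).d)⁻¹ * (((F.P K).L : ℝ)) ^ 2) ∧ Real.sqrt (((((F.P K).L : ℝ)) ^ (F.P K).d)⁻¹ * (((F.P K).L : ℝ)) ^ 2) < 1 ∧ Real.sqrt (((((F.P K).L : ℝ)) ^ (F.P K).d)⁻¹ * (((F.P K).L : ℝ)) ^ 2) ≤ 3 / 5 ∧ Real.sqrt (((((F.P K).L : ℝ)) ^ (F.P K).d)⁻¹ * (((F.P K).L : ℝ)) ^ 2) ^ 2 * (F.L : ℝ) = 1 := by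
  have hL3 := three_le_L F
  have hd : (F.P K).d = 3 := rfl
  have hLF : (((F.P K).L : ℝ)) = (F.L : ℝ) := rfl
  rw [hd, hLF]
  have hL0 : (0 : ℝ) < (F.L : ℝ) := by linarith
  have hLne : (F.L : ℝ) ≠ 0 := hL0.ne'
  have hin : ((F.L : ℝ) ^ 3)⁻¹ * (F.L : ℝ) ^ 2 = (F.L : ℝ)⁻¹ := by field_simp
  rw [hin]
  have hsq : Real.sqrt ((F.L : ℝ)⁻¹) ^ 2 = (F.L : ℝ)⁻¹ := Real.sq_sqrt (by positivity)
  have hpos : 0 < Real.sqrt ((F.L : ℝ)⁻¹) := Real.sqrt_pos.2 (by positivity)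
  have hinv : (F.L : ℝ)⁻¹ ≤ 1 / 3 := by rw [inv_eq_one_div]; exact one_div_le_one_div_of_le (by norm_num) hL3
  have h35 : Real.sqrt ((F.L : ℝ)⁻¹) ≤ 3 / 5 := by nlinarith [hsq, hpos, hinv]
  refine ⟨hpos, by linarith, h35, ?_⟩
  rw [hsq]; field_simp

/-- `D = 2√d` at d = 3: `0 ≤ D`, `D² = 12`, `D ≤ 7/2`. [folklore] -/
theorem two_sqrt_d_facts (F : T3Family) (K : ℕ) :
    0 ≤ 2 * Real.sqrt (F.P K).d ∧ (2 * Real.sqrt (F.P K).d) ^ 2 = 12 ∧ 2 * Real.sqrt (F.P K).d ≤ 7 / 2 := by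
  have hd : (F.P K).d = 3 := rfl
  rw [hd]
  push_cast
  have h3 : Real.sqrt (3 : ℝ) ^ 2 = 3 := Real.sq_sqrt (by norm_num)
  have h0 : 0 ≤ Real.sqrt (3 : ℝ) := Real.sqrt_nonneg _
  refine ⟨by positivity, by nlinarith [h3], by nlinarith [h3, h0]⟩

/-- `C_CM ≤ 25L²` at d = 3, `N = 2`, plaquette size `a′ = 4ε`, under `10⁶L⁵ε ≤ 1`. [cite: Balaban1984PropagatorsI, (1.18)-(1.20) pp.19-20] -/
theorem ccm_le (F : T3Family) (K : ℕ) {ε : ℝ} (hε : 0 < ε) (hεL : 1000000 * (F.L : ℝ) ^ 5 * ε ≤ 1) :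
    Real.sqrt (4 * (F.P K).d * ((((F.P K).d : ℝ) + 2) ^ 2 * (2 : ℕ) * (((F.P K).L : ℝ)) ^ 4) + (4 * (((F.P K).d : ℝ) + 2) ^ 2 * ((F.P K).d : ℝ) ^ 3 * (3 * (2 : ℕ) + 2 * (F.P K).d) * (((F.P K).L : ℝ)) ^ 6) * (2 * (2 * ε)) ^ 2) ≤ 25 * (F.L : ℝ) ^ 2 := by
  have hL3 := three_le_L F
  have hdn : (F.P K).d = 3 := rfl
  have hLF : (((F.P K).L : ℝ)) = (F.L : ℝ) := rfl
  have hL1 : (1 : ℝ) ≤ (F.L : ℝ) := by linarith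
  have hLe : (F.L : ℝ) * ε ≤ 1 / 1000000 := by
    have h5 : (F.L : ℝ) ≤ (F.L : ℝ) ^ 5 := by
      calc (F.L : ℝ) = (F.L : ℝ) ^ 1 := (pow_one _).symm
        _ ≤ (F.L : ℝ) ^ 5 := pow_le_pow_right₀ hL1 (by norm_num)
    have := mul_le_mul_of_nonneg_right h5 hε.le
    linarith
  have hLe2 : ((F.L : ℝ) * ε) ^ 2 ≤ 1 / 1000000 := by
    have h0 : 0 ≤ (F.L : ℝ) * ε := by positivity
    nlinarith
  have h4 : 0 ≤ (F.L : ℝ) ^ 4 := by positivity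
  have hsq : (Real.sqrt (4 * (F.P K).d * ((((F.P K).d : ℝ) + 2) ^ 2 * (2 : ℕ) * (((F.P K).L : ℝ)) ^ 4) + (4 * (((F.P K).d : ℝ) + 2) ^ 2 * ((F.P K).d : ℝ) ^ 3 * (3 * (2 : ℕ) + 2 * (F.P K).d) * (((F.P K).L : ℝ)) ^ 6) * (2 * (2 * ε)) ^ 2)) ^ 2 ≤ (25 * (F.L : ℝ) ^ 2) ^ 2 := by
    rw [Real.sq_sqrt (by positivity)]
    simp only [hdn, hLF]
    push_cast
    nlinarith [mul_le_mul_of_nonneg_left hLe2 h4]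
  have h0 : 0 ≤ Real.sqrt (4 * (F.P K).d * ((((F.P K).d : ℝ) + 2) ^ 2 * (2 : ℕ) * (((F.P K).L : ℝ)) ^ 4) + (4 * (((F.P K).d : ℝ) + 2) ^ 2 * ((F.P K).d : ℝ) ^ 3 * (3 * (2 : ℕ) + 2 * (F.P K).d) * (((F.P K).L : ℝ)) ^ 6) * (2 * (2 * ε)) ^ 2) := Real.sqrt_nonneg _
  have h1 : (0 : ℝ) ≤ 25 * (F.L : ℝ) ^ 2 := by positivity
  nlinarith [hsq, h0, h1]

/-- `C₁ = (d+2)L·√((2dL^d)(2d)) ≤ 30L³` at d = 3. [folklore] -/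
theorem c1_le (F : T3Family) (K : ℕ) : (((((F.P K).d + 2) * (F.P K).L : ℕ) : ℝ) * Real.sqrt (2 * (F.P K).d * (((F.P K).L : ℝ)) ^ (F.P K).d * (2 * (F.P K).d))) ≤ 30 * (F.L : ℝ) ^ 3 := by
  have hL3 := three_le_L F
  have hdn : (F.P K).d = 3 := rfl
  have hLF : (((F.P K).L : ℝ)) = (F.L : ℝ) := rfl
  have hLF' : (F.P K).L = F.L := rfl
  have hL1 : (1 : ℝ) ≤ (F.L : ℝ) := by linarith
  have h34 : (F.L : ℝ) ^ 3 ≤ (F.L : ℝ) ^ 4 := pow_le_pow_right₀ hL1 (by norm_num)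
  have hsq : ((((((F.P K).d + 2) * (F.P K).L : ℕ) : ℝ) * Real.sqrt (2 * (F.P K).d * (((F.P K).L : ℝ)) ^ (F.P K).d * (2 * (F.P K).d)))) ^ 2 ≤ (30 * (F.L : ℝ) ^ 3) ^ 2 := by
    rw [mul_pow, Real.sq_sqrt (by positivity)]
    simp only [hdn, hLF']
    push_cast
    nlinarith [h34]
  have h0 : 0 ≤ (((((F.P K).d + 2) * (F.P K).L : ℕ) : ℝ) * Real.sqrt (2 * (F.P K).d * (((F.P K).L : ℝ)) ^ (F.P K).d * (2 * (F.P K).d))) := by positivity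
  have h1 : (0 : ℝ) ≤ 30 * (F.L : ℝ) ^ 3 := by positivity
  nlinarith [hsq, h0, h1]

/-- `0 ≤ K₀ = 1 + 2√d·C_CM·ρ/(1−ρ)`. [folklore] -/
theorem K0_nonneg (F : T3Family) (K : ℕ) {ε : ℝ} : 0 ≤ (1 + 2 * Real.sqrt (F.P K).d * Real.sqrt (4 * (F.P K).d * ((((F.P K).d : ℝ) + 2) ^ 2 * (2 : ℕ) * (((F.P K).L : ℝ)) ^ 4) + (4 * (((F.P K).d : ℝ) + 2) ^ 2 * ((F.P K).d : ℝ) ^ 3 * (3 * (2 : ℕ) + 2 * (F.P K).d) * (((F.P K).L : ℝ)) ^ 6) * (2 * (2 * ε)) ^ 2) * (Real.sqrt (((((F.P K).L : ℝ)) ^ (F.P K).d)⁻¹ * (((F.P K).L : ℝ)) ^ 2) / (1 - Real.sqrt (((((F.P K).L : ℝ)) ^ (F.P K).d)⁻¹ * (((F.P K).L : ℝ)) ^ 2)))) := by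
  obtain ⟨hρ0, hρ1, -, -⟩ := rho_facts F K
  obtain ⟨hD0, -, -⟩ := two_sqrt_d_facts F K
  have : 0 ≤ 2 * Real.sqrt (F.P K).d * Real.sqrt (4 * (F.P K).d * ((((F.P K).d : ℝ) + 2) ^ 2 * (2 : ℕ) * (((F.P K).L : ℝ)) ^ 4) + (4 * (((F.P K).d : ℝ) + 2) ^ 2 * ((F.P K).d : ℝ) ^ 3 * (3 * (2 : ℕ) + 2 * (F.P K).d) * (((F.P K).L : ℝ)) ^ 6) * (2 * (2 * ε)) ^ 2) * (Real.sqrt (((((F.P K).L : ℝ)) ^ (F.P K).d)⁻¹ * (((F.P K).L : ℝ)) ^ 2) / (1 - Real.sqrt (((((F.P K).L : ℝ)) ^ (F.P K).d)⁻¹ * (((F.P K).L : ℝ)) ^ 2))) :=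
    mul_nonneg (mul_nonneg hD0 (Real.sqrt_nonneg _)) (div_nonneg hρ0.le (by linarith))
  linarith

/-- The gauge-sum factor `K₀ = 1 + 2√d·C_CM·ρ/(1−ρ) ≤ 132L²` at d = 3, `N = 2`, `a′ = 4ε`, `10⁶L⁵ε ≤ 1`. [folklore] -/
theorem K0_le (F : T3Family) (K : ℕ) {ε : ℝ} (hε : 0 < ε) (hεL : 1000000 * (F.L : ℝ) ^ 5 * ε ≤ 1) :
    (1 + 2 * Real.sqrt (F.P K).d * Real.sqrt (4 * (F.P K).d * ((((F.P K).d : ℝ) + 2) ^ 2 * (2 : ℕ) * (((F.P K).L : ℝ)) ^ 4) + (4 * (((F.P K).d : ℝ) + 2) ^ 2 * ((F.P K).d : ℝ) ^ 3 * (3 * (2 : ℕ) + 2 * (F.P K).d) * (((F.P K).L : ℝ)) ^ 6) * (2 * (2 * ε)) ^ 2) * (Real.sqrt (((((F.P K).L : ℝ)) ^ (F.P K).d)⁻¹ * (((F.P K).L : ℝ)) ^ 2) / (1 - Real.sqrt (((((F.P K).L : ℝ)) ^ (F.P K).d)⁻¹ * (((F.P K).L : ℝ)) ^ 2)))) ≤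 132 * (F.L : ℝ) ^ 2 := by
  have hL3 := three_le_L F
  obtain ⟨hρ0, -, hρ35, -⟩ := rho_facts F K
  obtain ⟨hD0, -, hD⟩ := two_sqrt_d_facts F K
  have hC := ccm_le F K hε hεL
  have hC0 : 0 ≤ Real.sqrt (4 * (F.P K).d * ((((F.P K).d : ℝ) + 2) ^ 2 * (2 : ℕ) * (((F.P K).L : ℝ)) ^ 4) + (4 * (((F.P K).d : ℝ) + 2) ^ 2 * ((F.P K).d : ℝ) ^ 3 * (3 * (2 : ℕ) + 2 * (F.P K).d) * (((F.P K).L : ℝ)) ^ 6) * (2 * (2 * ε)) ^ 2) := Real.sqrt_nonneg _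
  have hfrac : Real.sqrt (((((F.P K).L : ℝ)) ^ (F.P K).d)⁻¹ * (((F.P K).L : ℝ)) ^ 2) / (1 - Real.sqrt (((((F.P K).L : ℝ)) ^ (F.P K).d)⁻¹ * (((F.P K).L : ℝ)) ^ 2)) ≤ 3 / 2 := by
    rw [div_le_iff₀ (by linarith)]; linarith
  have hfrac0 : 0 ≤ Real.sqrt (((((F.P K).L : ℝ)) ^ (F.P K).d)⁻¹ * (((F.P K).L : ℝ)) ^ 2) / (1 - Real.sqrt (((((F.P K).L : ℝ)) ^ (F.P K).d)⁻¹ * (((F.P K).L : ℝ)) ^ 2)) := div_nonneg hρ0.le (by linarith)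
  have h1 : 2 * Real.sqrt (F.P K).d * Real.sqrt (4 * (F.P K).d * ((((F.P K).d : ℝ) + 2) ^ 2 * (2 : ℕ) * (((F.P K).L : ℝ)) ^ 4) + (4 * (((F.P K).d : ℝ) + 2) ^ 2 * ((F.P K).d : ℝ) ^ 3 * (3 * (2 : ℕ) + 2 * (F.P K).d) * (((F.P K).L : ℝ)) ^ 6) * (2 * (2 * ε)) ^ 2) * (Real.sqrt (((((F.P K).L : ℝ)) ^ (F.P K).d)⁻¹ * (((F.P K).L : ℝ)) ^ 2) / (1 - Real.sqrt (((((F.P K).L : ℝ)) ^ (F.P K).d)⁻¹ * (((F.P K).L : ℝ)) ^ 2)))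
      ≤ 7 / 2 * (25 * (F.L : ℝ) ^ 2) * (3 / 2) :=
    mul_le_mul (mul_le_mul hD hC hC0 (by norm_num)) hfrac hfrac0 (by positivity)
  have hL9 : (9 : ℝ) ≤ (F.L : ℝ) ^ 2 := by nlinarith
  nlinarith [h1, hL9]

/-- `ρ³/(1−ρ⁴) ≤ (7/10)·L⁻¹` at d = 3. [folklore] -/
theorem q_le (F : T3Family) (K : ℕ) : (Real.sqrt (((((F.P K).L : ℝ)) ^ (F.P K).d)⁻¹ * (((F.P K).L : ℝ)) ^ 2) ^ 3 / (1 - Real.sqrt (((((F.P K).L : ℝ)) ^ (F.P K).d)⁻¹ * (((F.P K).L : ℝ)) ^ 2) ^ 4)) ≤ 7 / 10 * ((F.L : ℝ))⁻¹ := by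
  have hL3 := three_le_L F
  have hL0 : (0 : ℝ) < (F.L : ℝ) := by linarith
  obtain ⟨hρ0, hρ1, hρ35, hρ2L⟩ := rho_facts F K
  have hρ2 : Real.sqrt (((((F.P K).L : ℝ)) ^ (F.P K).d)⁻¹ * (((F.P K).L : ℝ)) ^ 2) ^ 2 = ((F.L : ℝ))⁻¹ := eq_inv_of_mul_eq_one_left hρ2L
  have hρ4 : Real.sqrt (((((F.P K).L : ℝ)) ^ (F.P K).d)⁻¹ * (((F.P K).L : ℝ)) ^ 2) ^ 4 = ((F.L : ℝ))⁻¹ ^ 2 := by rw [← hρ2]; ring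
  have hinv3 : ((F.L : ℝ))⁻¹ ≤ 1 / 3 := by rw [inv_eq_one_div]; exact one_div_le_one_div_of_le (by norm_num) hL3
  have hinv0 : 0 < ((F.L : ℝ))⁻¹ := by positivity
  have hden : 8 / 9 ≤ 1 - Real.sqrt (((((F.P K).L : ℝ)) ^ (F.P K).d)⁻¹ * (((F.P K).L : ℝ)) ^ 2) ^ 4 := by rw [hρ4]; nlinarith
  have hnum : Real.sqrt (((((F.P K).L : ℝ)) ^ (F.P K).d)⁻¹ * (((F.P K).L : ℝ)) ^ 2) ^ 3 ≤ 3 / 5 * ((F.L : ℝ))⁻¹ := by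
    have : Real.sqrt (((((F.P K).L : ℝ)) ^ (F.P K).d)⁻¹ * (((F.P K).L : ℝ)) ^ 2) ^ 3 = Real.sqrt (((((F.P K).L : ℝ)) ^ (F.P K).d)⁻¹ * (((F.P K).L : ℝ)) ^ 2) * ((F.L : ℝ))⁻¹ := by rw [pow_succ', hρ2]
    rw [this]; exact mul_le_mul_of_nonneg_right hρ35 hinv0.le
  rw [div_le_iff₀ (by linarith)]
  nlinarith [hnum, hden, hinv0]

/-- THE ONE SMALLNESS: `1000·θ·L ≤ 1` gives `θ·(3/2)·K₀·(ρ³/(1−ρ⁴)) ≤ 1/2` (the scalar induction's hypothesis). [folklore] -/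
theorem theta_smallness (F : T3Family) (K : ℕ) {ε : ℝ} (hε : 0 < ε) (hεL : 1000000 * (F.L : ℝ) ^ 5 * ε ≤ 1)
    {θ : ℝ} (hθ0 : 0 ≤ θ) (hθL : 1000 * θ * (F.L : ℝ) ≤ 1) :
    θ * (3 / 2) * (1 + 2 * Real.sqrt (F.P K).d * Real.sqrt (4 * (F.P K).d * ((((F.P K).d : ℝ) + 2) ^ 2 * (2 : ℕ) * (((F.P K).L : ℝ)) ^ 4) + (4 * (((F.P K).d : ℝ) + 2) ^ 2 * ((F.P K).d : ℝ) ^ 3 * (3 * (2 : ℕ) + 2 * (F.P K).d) * (((F.P K).L : ℝ)) ^ 6) * (2 * (2 * ε)) ^ 2) * (Real.sqrt (((((F.P K).L : ℝ)) ^ (F.P K).d)⁻¹ * (((F.P K).L : ℝ)) ^ 2) / (1 - Real.sqrt (((((F.P K).L : ℝ)) ^ (F.P K).d)⁻¹ * (((F.P K).L : ℝ)) ^ 2)))) * (Real.sqrt (((((F.P K).L : ℝ)) ^ (F.P K).d)⁻¹ * (((F.P K).L : ℝ)) ^ 2) ^ 3 / (1 - Real.sqrt (((((F.P K).L : ℝ))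 ^ (F.P K).d)⁻¹ * (((F.P K).L : ℝ)) ^ 2) ^ 4)) ≤ 1 / 2 := by
  have hL3 := three_le_L F
  have hL0 : (0 : ℝ) < (F.L : ℝ) := by linarith
  have hK := K0_le F K hε hεL
  have hK0 := K0_nonneg F K (ε := ε)
  have hq := q_le F K
  obtain ⟨hρ0, hρ1, -, -⟩ := rho_facts F K
  have hq0 : 0 ≤ (Real.sqrt (((((F.P K).L : ℝ)) ^ (F.P K).d)⁻¹ * (((F.P K).L : ℝ)) ^ 2) ^ 3 / (1 - Real.sqrt (((((F.P K).L : ℝ)) ^ (F.P K).d)⁻¹ * (((F.P K).L : ℝ)) ^ 2) ^ 4)) := div_nonneg (pow_nonneg hρ0.le 3) (sub_nonneg.2 (pow_le_one₀ hρ0.le hρ1.le))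
  have h1 : (1 + 2 * Real.sqrt (F.P K).d * Real.sqrt (4 * (F.P K).d * ((((F.P K).d : ℝ) + 2) ^ 2 * (2 : ℕ) * (((F.P K).L : ℝ)) ^ 4) + (4 * (((F.P K).d : ℝ) + 2) ^ 2 * ((F.P K).d : ℝ) ^ 3 * (3 * (2 : ℕ) + 2 * (F.P K).d) * (((F.P K).L : ℝ)) ^ 6) * (2 * (2 * ε)) ^ 2) * (Real.sqrt (((((F.P K).L : ℝ)) ^ (F.P K).d)⁻¹ * (((F.P K).L : ℝ)) ^ 2) / (1 - Real.sqrt (((((F.P K).L : ℝ)) ^ (F.P K).d)⁻¹ * (((F.P K).L : ℝ)) ^ 2)))) * (Real.sqrt (((((F.P K).L : ℝ)) ^ (F.P K).d)⁻¹ * (((F.P K).L : ℝ)) ^ 2) ^ 3 / (1 - Real.sqrt (((((F.P K).L : ℝ)) ^ (F.P K).d)⁻¹ * (((F.P K).L : ℝ)) ^ 2) ^ 4)) ≤ (132 * (F.L : ℝ) ^ 2) * (7 / 10 * ((F.L : ℝ))⁻¹) := mul_le_mul hK hq hq0 (by positivity)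
  have h2 : (132 * (F.L : ℝ) ^ 2) * (7 / 10 * ((F.L : ℝ))⁻¹) = 462 / 5 * (F.L : ℝ) := by
    have hLne : (F.L : ℝ) ≠ 0 := hL0.ne'
    field_simp
    ring
  rw [h2] at h1
  have h3 : θ * (3 / 2) * (1 + 2 * Real.sqrt (F.P K).d * Real.sqrt (4 * (F.P K).d * ((((F.P K).d : ℝ) + 2) ^ 2 * (2 : ℕ) * (((F.P K).L : ℝ)) ^ 4) + (4 * (((F.P K).d : ℝ) + 2) ^ 2 * ((F.P K).d : ℝ) ^ 3 * (3 * (2 : ℕ) + 2 * (F.P K).d) * (((F.P K).L : ℝ)) ^ 6) * (2 * (2 * ε)) ^ 2) * (Real.sqrt (((((F.P K).L : ℝ)) ^ (F.P K).d)⁻¹ * (((F.P K).L : ℝ)) ^ 2) / (1 - Real.sqrt (((((F.P K).L : ℝ)) ^ (F.P K).d)⁻¹ * (((F.P K).L : ℝ)) ^ 2)))) * (Real.sqrt (((((F.P K).L : ℝ)) ^ (F.P K).d)⁻¹ * (((F.P K).L : ℝ)) ^ 2) ^ 3 / (1 - Real.sqrt (((((F.P K).L : ℝ)) ^ (F.P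 K).d)⁻¹ * (((F.P K).L : ℝ)) ^ 2) ^ 4)) = θ * (3 / 2) * ((1 + 2 * Real.sqrt (F.P K).d * Real.sqrt (4 * (F.P K).d * ((((F.P K).d : ℝ) + 2) ^ 2 * (2 : ℕ) * (((F.P K).L : ℝ)) ^ 4) + (4 * (((F.P K).d : ℝ) + 2) ^ 2 * ((F.P K).d : ℝ) ^ 3 * (3 * (2 : ℕ) + 2 * (F.P K).d) * (((F.P K).L : ℝ)) ^ 6) * (2 * (2 * ε)) ^ 2) * (Real.sqrt (((((F.P K).L : ℝ)) ^ (F.P K).d)⁻¹ * (((F.P K).L : ℝ)) ^ 2) / (1 - Real.sqrt (((((F.P K).L : ℝ)) ^ (F.P K).d)⁻¹ * (((F.P K).L : ℝ)) ^ 2)))) * (Real.sqrt (((((F.P K).L : ℝ)) ^ (F.P K).d)⁻¹ * (((F.P K).L : ℝ)) ^ 2) ^ 3 / (1 - Real.sqrt (((((F.P K).L : ℝ)) ^ (F.P K).d)⁻¹ * (((F.P K).L : ℝ)) ^ 2) ^ 4))) := by ring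
  rw [h3]
  have h4 := mul_le_mul_of_nonneg_left h1 (by positivity : 0 ≤ θ * (3 / 2))
  nlinarith [h4, hθL, hθ0]

/-- THE (B6)-SHAPE COEFFICIENT: `7800·L³·ℓ·m ≤ θ·Lˡ` (`l ≤ K − n`, `m ≥ 0`) gives `260·m·C₁ ≤ θ·ρ^{2((K−n)−l)}` (`C₁ ≤ 30L³`, `ρ²L = 1`). [folklore] -/
theorem coeff_of_B6 (F : T3Family) (n K : ℕ) {m θ : ℝ} {l : ℕ} (hl : l ≤ K - n) (hm : 0 ≤ m)
    (h : 7800 * (F.L : ℝ) ^ 3 * (F.L : ℝ) ^ (K - n) * m ≤ θ * (F.L : ℝ) ^ l) :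
    260 * (m * (((((F.P K).d + 2) * (F.P K).L : ℕ) : ℝ) * Real.sqrt (2 * (F.P K).d * (((F.P K).L : ℝ)) ^ (F.P K).d * (2 * (F.P K).d)))) ≤ θ * Real.sqrt (((((F.P K).L : ℝ)) ^ (F.P K).d)⁻¹ * (((F.P K).L : ℝ)) ^ 2) ^ (2 * ((K - n) - l)) := by
  have hL3 := three_le_L F
  obtain ⟨-, -, -, hρ2L⟩ := rho_facts F K
  have hC1 := c1_le F K
  have h1 : 260 * (m * (((((F.P K).d + 2) * (F.P K).L : ℕ) : ℝ) * Real.sqrt (2 * (F.P K).d * (((F.P K).L : ℝ)) ^ (F.P K).d * (2 * (F.P K).d)))) ≤ 7800 * (F.L : ℝ) ^ 3 * m := by nlinarith [mul_le_mul_of_nonneg_left hC1 hm]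
  have hρpow : Real.sqrt (((((F.P K).L : ℝ)) ^ (F.P K).d)⁻¹ * (((F.P K).L : ℝ)) ^ 2) ^ (2 * ((K - n) - l)) * (F.L : ℝ) ^ (K - n) = (F.L : ℝ) ^ l := by
    rw [pow_mul]
    have hLk : (F.L : ℝ) ^ (K - n) = (F.L : ℝ) ^ ((K - n) - l) * (F.L : ℝ) ^ l := by rw [← pow_add]; congr 1; omega
    rw [hLk, ← mul_assoc, ← mul_pow, hρ2L, one_pow, one_mul]
  rw [← hρpow] at h
  have hLk : 0 < (F.L : ℝ) ^ (K - n) := by positivity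
  have h3 : 7800 * (F.L : ℝ) ^ 3 * m ≤ θ * Real.sqrt (((((F.P K).L : ℝ)) ^ (F.P K).d)⁻¹ * (((F.P K).L : ℝ)) ^ 2) ^ (2 * ((K - n) - l)) := by
    have h2' : (7800 * (F.L : ℝ) ^ 3 * m) * (F.L : ℝ) ^ (K - n) ≤ (θ * Real.sqrt (((((F.P K).L : ℝ)) ^ (F.P K).d)⁻¹ * (((F.P K).L : ℝ)) ^ 2) ^ (2 * ((K - n) - l))) * (F.L : ℝ) ^ (K - n) := by
      linarith [h]
    exact le_of_mul_le_mul_right h2' hLk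
  exact h1.trans h3

/-- The level exponentials: `E_j = exp((κ/ρ)·Σ_{i<j}a_i) ≤ 3/2` for `j ≤ K − n` (`a_i = ((d+2)L)²/2·2ε·L^{2i}/L^{2(K−n)}`; `κ/ρ·Σa ≤ 1/3` under `10⁶L⁵ε ≤ 1`).
[cite: Balaban1985Averaging, Prop. 3 (124)-(126) p.36] -/
theorem level_exp_le (F : T3Family) (n K : ℕ) {ε : ℝ} (hε : 0 < ε) (hεL : 1000000 * (F.L : ℝ) ^ 5 * ε ≤ 1) (j : ℕ) (hj : j ≤ K - n) :
    Real.exp ((159 * ((((F.P K).d + 2) * (F.P K).L : ℕ) : ℝ) * Real.sqrt (2 * (F.P K).d * (((F.P K).L : ℝ)) ^ (F.P K).d * (2 * (F.P K).d))) / Real.sqrt (((((F.P K).L : ℝ)) ^ (F.P K).d)⁻¹ * (((F.P K).L : ℝ)) ^ 2) * ∑ i ∈ Finset.range j, (((((F.P K).d + 2) * (F.P K).L : ℕ) : ℝ) ^ 2 / 2 * (2 * ε) * ((((F.P K).L : ℝ)) ^ (2 * i) / (((F.P K).L : ℝ)) ^ (2 * (K - n))))) ≤ 3 / 2 := by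
  have hL3 := three_le_L F
  have hLF : (((F.P K).L : ℝ)) = (F.L : ℝ) := rfl
  obtain ⟨-, -, -, -, hεκ⟩ := smallness_T3 F K hε hεL
  have hL2 : (2 : ℝ) ≤ ((F.P K).L : ℝ) := by rw [hLF]; linarith
  have hρpos : 0 < Real.sqrt (((((F.P K).L : ℝ)) ^ (F.P K).d)⁻¹ * (((F.P K).L : ℝ)) ^ 2) := (rho_facts F K).1
  rw [kappa_eq_mul_rho (F.P K), mul_div_assoc, div_self hρpos.ne', mul_one]
  refine (Real.exp_le_exp.2 ?_).trans exp_third_le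
  have ha0 : ∀ i ∈ Finset.range (K - n), 0 ≤ (((((F.P K).d + 2) * (F.P K).L : ℕ) : ℝ) ^ 2 / 2 * (2 * ε) * ((((F.P K).L : ℝ)) ^ (2 * i) / (((F.P K).L : ℝ)) ^ (2 * (K - n)))) := fun i _ => by positivity
  have hmono : ∑ i ∈ Finset.range j, (((((F.P K).d + 2) * (F.P K).L : ℕ) : ℝ) ^ 2 / 2 * (2 * ε) * ((((F.P K).L : ℝ)) ^ (2 * i) / (((F.P K).L : ℝ)) ^ (2 * (K - n)))) ≤ ∑ i ∈ Finset.range (K - n), (((((F.P K).d + 2) * (F.P K).L : ℕ) : ℝ) ^ 2 / 2 * (2 * ε) * ((((F.P K).L : ℝ)) ^ (2 * i) / (((F.P K).L : ℝ)) ^ (2 * (K - n)))) :=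
    Finset.sum_le_sum_of_subset_of_nonneg (Finset.range_mono hj) (fun i hi _ => ha0 i hi)
  have hA3 : ∑ i ∈ Finset.range (K - n), (((((F.P K).d + 2) * (F.P K).L : ℕ) : ℝ) ^ 2 / 2 * (2 * ε) * ((((F.P K).L : ℝ)) ^ (2 * i) / (((F.P K).L : ℝ)) ^ (2 * (K - n)))) ≤ ((((F.P K).d + 2) * (F.P K).L : ℕ) : ℝ) ^ 2 / 2 * (2 * ε) / 3 := by
    rw [← Finset.mul_sum]
    have := sum_range_pow_div_le_third hL2 (K - n)
    have h0 : 0 ≤ ((((F.P K).d + 2) * (F.P K).L : ℕ) : ℝ) ^ 2 / 2 * (2 * ε) := by positivity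
    nlinarith
  have hMCa : 318 * (F.P K).d * (((F.P K).d : ℝ) + 2) * ((F.P K).L : ℝ) ^ (F.P K).d * (((((F.P K).d + 2) * (F.P K).L : ℕ) : ℝ) ^ 2 / 2 * (2 * ε)) ≤ 1 := by
    have : 318 * (F.P K).d * (((F.P K).d : ℝ) + 2) * ((F.P K).L : ℝ) ^ (F.P K).d * (((((F.P K).d + 2) * (F.P K).L : ℕ) : ℝ) ^ 2 / 2 * (2 * ε))
        = 159 * (F.P K).d * (((F.P K).d : ℝ) + 2) ^ 3 * ((F.P K).L : ℝ) ^ ((F.P K).d + 2) * (2 * ε) := by push_cast; ring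
    rw [this]; exact hεκ
  have hM0 : (0 : ℝ) ≤ 318 * (F.P K).d * (((F.P K).d : ℝ) + 2) * ((F.P K).L : ℝ) ^ (F.P K).d := by positivity
  linarith [mul_le_mul_of_nonneg_left (hmono.trans hA3) hM0, hMCa]

/-- `ρⁱ·√X ≤ √B` whenever `0 ≤ X ≤ Lⁱ·B` (`ρ²L = 1`). [folklore] -/
theorem rho_pow_mul_sqrt_le (F : T3Family) (K : ℕ) {i : ℕ} {X B : ℝ} (hX : 0 ≤ X) (h : X ≤ (F.L : ℝ) ^ i * B) :
    Real.sqrt (((((F.P K).L : ℝ)) ^ (F.P K).d)⁻¹ * (((F.P K).L : ℝ)) ^ 2) ^ i * Real.sqrt X ≤ Real.sqrt B := by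
  obtain ⟨hρ0, -, -, hρ2L⟩ := rho_facts F K
  have h1 : (Real.sqrt (((((F.P K).L : ℝ)) ^ (F.P K).d)⁻¹ * (((F.P K).L : ℝ)) ^ 2) ^ i * Real.sqrt X) ^ 2 ≤ B := by
    rw [mul_pow, Real.sq_sqrt hX]
    calc (Real.sqrt (((((F.P K).L : ℝ)) ^ (F.P K).d)⁻¹ * (((F.P K).L : ℝ)) ^ 2) ^ i) ^ 2 * X ≤ (Real.sqrt (((((F.P K).L : ℝ)) ^ (F.P K).d)⁻¹ * (((F.P K).L : ℝ)) ^ 2) ^ i) ^ 2 * ((F.L : ℝ) ^ i * B) := mul_le_mul_of_nonneg_left h (sq_nonneg _)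
      _ = (Real.sqrt (((((F.P K).L : ℝ)) ^ (F.P K).d)⁻¹ * (((F.P K).L : ℝ)) ^ 2) ^ 2 * (F.L : ℝ)) ^ i * B := by ring
      _ = B := by rw [hρ2L, one_pow, one_mul]
  calc Real.sqrt (((((F.P K).L : ℝ)) ^ (F.P K).d)⁻¹ * (((F.P K).L : ℝ)) ^ 2) ^ i * Real.sqrt X ≤ |Real.sqrt (((((F.P K).L : ℝ)) ^ (F.P K).d)⁻¹ * (((F.P K).L : ℝ)) ^ 2) ^ i * Real.sqrt X| := le_abs_self _
    _ = Real.sqrt ((Real.sqrt (((((F.P K).L : ℝ)) ^ (F.P K).d)⁻¹ * (((F.P K).L : ℝ)) ^ 2) ^ i * Real.sqrt X) ^ 2) := (Real.sqrt_sq_eq_abs _).symm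
    _ ≤ Real.sqrt B := Real.sqrt_le_sqrt h1

/-- `ρᵏ·R ≤ W` with `R ≥ 0` gives `R² ≤ Lᵏ·W²` (`ρ²L = 1`). [folklore] -/
theorem sq_le_of_rho_pow_mul_le (F : T3Family) (K : ℕ) (k : ℕ) {R W : ℝ} (hR : 0 ≤ R) (h : Real.sqrt (((((F.P K).L : ℝ)) ^ (F.P K).d)⁻¹ * (((F.P K).L : ℝ)) ^ 2) ^ k * R ≤ W) :
    R ^ 2 ≤ (F.L : ℝ) ^ k * W ^ 2 := by
  have hL3 := three_le_L F
  obtain ⟨hρ0, -, -, hρ2L⟩ := rho_facts F K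
  have hρk2 : (Real.sqrt (((((F.P K).L : ℝ)) ^ (F.P K).d)⁻¹ * (((F.P K).L : ℝ)) ^ 2) ^ k) ^ 2 * (F.L : ℝ) ^ k = 1 := by
    rw [← pow_mul, show k * 2 = 2 * k by ring, pow_mul, ← mul_pow, hρ2L, one_pow]
  have h1 := pow_le_pow_left₀ (mul_nonneg (pow_nonneg hρ0.le k) hR) h 2
  have h3 : R ^ 2 = (Real.sqrt (((((F.P K).L : ℝ)) ^ (F.P K).d)⁻¹ * (((F.P K).L : ℝ)) ^ 2) ^ k * R) ^ 2 * (F.L : ℝ) ^ k := by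
    rw [mul_pow, mul_comm ((Real.sqrt (((((F.P K).L : ℝ)) ^ (F.P K).d)⁻¹ * (((F.P K).L : ℝ)) ^ 2) ^ k) ^ 2), mul_assoc, hρk2, mul_one]
  rw [h3]
  exact (mul_le_mul_of_nonneg_right h1 (pow_nonneg (by linarith) k)).trans (le_of_eq (mul_comm _ _))

set_option maxHeartbeats 400000 in
/-- THE NUMERIC END-GAME (pure reals): with `ρ²L = 1`, `D² = 12`, `K₀ ≤ 132L²`, `L ≥ 3`,
`Lᵏ·(D√B + 2(θ·(3/2)·K₀·((3/2)·x₀·ρ^{2k+1}/(1−ρ²))))² ≤ 24·Lᵏ·B + 10⁶·L⁴·θ²·(Lᵏ)⁻¹·x₀²`. [folklore] -/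
theorem endgame {L ρ D K₀ B : ℝ} (θ x₀ : ℝ) (k : ℕ) (hL : 3 ≤ L) (hρL : ρ ^ 2 * L = 1) (hD : D ^ 2 = 12)
    (hK0 : 0 ≤ K₀) (hK : K₀ ≤ 132 * L ^ 2) (hB : 0 ≤ B) :
    L ^ k * (D * Real.sqrt B + 2 * (θ * (3 / 2) * K₀ * ((3 / 2) * x₀ * ρ ^ (2 * k + 1) / (1 - ρ ^ 2)))) ^ 2
      ≤ 24 * L ^ k * B + 1000000 * L ^ 4 * θ ^ 2 * (L ^ k)⁻¹ * x₀ ^ 2 := by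
  have hL0 : 0 < L := by linarith
  have hV : 0 < L ^ k := pow_pos hL0 k
  have hLne : L ≠ 0 := hL0.ne'
  have hL1ne : L - 1 ≠ 0 := by
    have : 0 < L - 1 := by linarith
    exact this.ne'
  have hLkne : L ^ k ≠ 0 := hV.ne'
  have hρ2 : ρ ^ 2 = L⁻¹ := eq_inv_of_mul_eq_one_left hρL
  have hs : 1 - ρ ^ 2 = (L - 1) / L := by rw [hρ2]; field_simp
  -- the one k-dependent identity: `Lᵏ·(ρ^{2k+1})²·(Lᵏ·L) = (ρ²L)^{2k+1} = 1`
  have hid : L ^ k * (ρ ^ (2 * k + 1)) ^ 2 * (L ^ k * L) = 1 := by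
    have : L ^ k * (ρ ^ (2 * k + 1)) ^ 2 * (L ^ k * L) = (ρ ^ 2 * L) ^ (2 * k + 1) := by ring
    rw [this, hρL, one_pow]
  have hu : L ^ k * (ρ ^ (2 * k + 1)) ^ 2 = (L ^ k)⁻¹ * L⁻¹ := by
    have hne : L ^ k * L ≠ 0 := by positivity
    rw [← mul_inv]
    exact eq_inv_of_mul_eq_one_left hid
  -- the square of the sum: `(a+b)² ≤ 2a² + 2b²`
  have hsq : (D * Real.sqrt B + 2 * (θ * (3 / 2) * K₀ * ((3 / 2) * x₀ * ρ ^ (2 * k + 1) / (1 - ρ ^ 2)))) ^ 2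
      ≤ 2 * (D * Real.sqrt B) ^ 2 + 2 * (2 * (θ * (3 / 2) * K₀ * ((3 / 2) * x₀ * ρ ^ (2 * k + 1) / (1 - ρ ^ 2)))) ^ 2 := by
    have e : (D * Real.sqrt B + 2 * (θ * (3 / 2) * K₀ * ((3 / 2) * x₀ * ρ ^ (2 * k + 1) / (1 - ρ ^ 2)))) ^ 2
        = 2 * (D * Real.sqrt B) ^ 2 + 2 * (2 * (θ * (3 / 2) * K₀ * ((3 / 2) * x₀ * ρ ^ (2 * k + 1) / (1 - ρ ^ 2)))) ^ 2
          - (D * Real.sqrt B - 2 * (θ * (3 / 2) * K₀ * ((3 / 2) * x₀ * ρ ^ (2 * k + 1) / (1 - ρ ^ 2)))) ^ 2 := by ring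
    rw [e]
    linarith [sq_nonneg (D * Real.sqrt B - 2 * (θ * (3 / 2) * K₀ * ((3 / 2) * x₀ * ρ ^ (2 * k + 1) / (1 - ρ ^ 2))))]
  have hDB : (D * Real.sqrt B) ^ 2 = 12 * B := by rw [mul_pow, hD, Real.sq_sqrt hB]
  -- the source part in closed form
  have hT2 : L ^ k * (2 * (θ * (3 / 2) * K₀ * ((3 / 2) * x₀ * ρ ^ (2 * k + 1) / (1 - ρ ^ 2)))) ^ 2
      = 81 / 4 * θ ^ 2 * K₀ ^ 2 * x₀ ^ 2 * (L / (L - 1) ^ 2) * (L ^ k)⁻¹ := by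
    calc L ^ k * (2 * (θ * (3 / 2) * K₀ * ((3 / 2) * x₀ * ρ ^ (2 * k + 1) / (1 - ρ ^ 2)))) ^ 2
        = 81 / 4 * θ ^ 2 * K₀ ^ 2 * x₀ ^ 2 * (L ^ k * (ρ ^ (2 * k + 1)) ^ 2) * (1 / (1 - ρ ^ 2)) ^ 2 := by ring
      _ = 81 / 4 * θ ^ 2 * K₀ ^ 2 * x₀ ^ 2 * ((L ^ k)⁻¹ * L⁻¹) * (1 / ((L - 1) / L)) ^ 2 := by rw [hu, hs]
      _ = 81 / 4 * θ ^ 2 * K₀ ^ 2 * x₀ ^ 2 * (L / (L - 1) ^ 2) * (L ^ k)⁻¹ := by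
          field_simp
  have hK2 : K₀ ^ 2 ≤ 17424 * L ^ 4 := by nlinarith [mul_le_mul hK hK hK0 (by positivity), hK0]
  have hfrac : L / (L - 1) ^ 2 ≤ 3 / 4 := by
    have hpos : (0 : ℝ) < (L - 1) ^ 2 := by positivity
    rw [div_le_iff₀ hpos]
    nlinarith [mul_nonneg (sub_nonneg.2 hL) (by linarith : (0 : ℝ) ≤ 3 * L - 1)]
  have hfrac0 : 0 ≤ L / (L - 1) ^ 2 := by positivity
  have h0 : 0 ≤ (θ ^ 2 * x₀ ^ 2 * (L ^ k)⁻¹) := by positivity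
  have hM0 : 0 ≤ L ^ 4 * (θ ^ 2 * x₀ ^ 2 * (L ^ k)⁻¹) := by positivity
  have hprod : K₀ ^ 2 * (L / (L - 1) ^ 2) ≤ 17424 * L ^ 4 * (3 / 4) := mul_le_mul hK2 hfrac hfrac0 (by positivity)
  have hA : K₀ ^ 2 * (L / (L - 1) ^ 2) * (θ ^ 2 * x₀ ^ 2 * (L ^ k)⁻¹) ≤ 13068 * (L ^ 4 * (θ ^ 2 * x₀ ^ 2 * (L ^ k)⁻¹)) := by
    have h := mul_le_mul_of_nonneg_right hprod h0
    have e : 17424 * L ^ 4 * (3 / 4) * (θ ^ 2 * x₀ ^ 2 * (L ^ k)⁻¹) = 13068 * (L ^ 4 * (θ ^ 2 * x₀ ^ 2 * (L ^ k)⁻¹)) := by ring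
    rw [e] at h
    exact h
  have hT2' : L ^ k * (2 * (θ * (3 / 2) * K₀ * ((3 / 2) * x₀ * ρ ^ (2 * k + 1) / (1 - ρ ^ 2)))) ^ 2 = 81 / 4 * (K₀ ^ 2 * (L / (L - 1) ^ 2) * (θ ^ 2 * x₀ ^ 2 * (L ^ k)⁻¹)) := by
    rw [hT2]; ring
  calc L ^ k * (D * Real.sqrt B + 2 * (θ * (3 / 2) * K₀ * ((3 / 2) * x₀ * ρ ^ (2 * k + 1) / (1 - ρ ^ 2)))) ^ 2
      ≤ L ^ k * (2 * (D * Real.sqrt B) ^ 2 + 2 * (2 * (θ * (3 / 2) * K₀ * ((3 / 2) * x₀ * ρ ^ (2 * k + 1) / (1 - ρ ^ 2)))) ^ 2) :=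
        mul_le_mul_of_nonneg_left hsq hV.le
    _ = 24 * L ^ k * B + 2 * (81 / 4 * (K₀ ^ 2 * (L / (L - 1) ^ 2) * (θ ^ 2 * x₀ ^ 2 * (L ^ k)⁻¹))) := by
        rw [hDB, mul_add, show L ^ k * (2 * (2 * (θ * (3 / 2) * K₀ * ((3 / 2) * x₀ * ρ ^ (2 * k + 1) / (1 - ρ ^ 2)))) ^ 2) = 2 * (L ^ k * (2 * (θ * (3 / 2) * K₀ * ((3 / 2) * x₀ * ρ ^ (2 * k + 1) / (1 - ρ ^ 2)))) ^ 2) by ring, hT2']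
        ring
    _ ≤ 24 * L ^ k * B + 2 * (81 / 4 * (13068 * (L ^ 4 * (θ ^ 2 * x₀ ^ 2 * (L ^ k)⁻¹)))) := by linarith [hA]
    _ ≤ 24 * L ^ k * B + 1000000 * L ^ 4 * θ ^ 2 * (L ^ k)⁻¹ * x₀ ^ 2 := by
        have e : 1000000 * L ^ 4 * θ ^ 2 * (L ^ k)⁻¹ * x₀ ^ 2 = 1000000 * (L ^ 4 * (θ ^ 2 * x₀ ^ 2 * (L ^ k)⁻¹)) := by ring
        rw [e]
        linarith [hM0]

/-! ## §2 ★ The `(H¹)^*` row of the coarse gauge function at every level -/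

/-- ★ **(R-B) AT EVERY LEVEL** (★routeR-w2's ✓ `sum_normSq_covIterLambda_le_curl_T3_su2` read at the run `n′ := K − i`, `ε′ := ε·L^{2i}·ℓ⁻²`): `U₀ ∈ SU(2)` with
`dist1(U₀(∂p)) ≤ εℓ⁻²`, `ℓ = L^{K−n}`, `10⁶L⁵ε ≤ 1`; `G, S, Λ` the recursion families of record at `Y`.  Then for every `i ≤ K − n`:
`Σ_y‖Λ_i(y)‖² ≤ Lⁱ·(200L⁴(CURL+DIV) + 4·10⁹L⁹εℓ⁻²Σ‖Y‖²)` — the bracket is i-INDEPENDENT. [cite: Balaban1985BackgroundPropagators, Thm 3.11 p.416; Balaban1984PropagatorsI, (1.18)-(1.20) pp.19-20] -/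
theorem sum_normSq_covIterLambda_le_level (F : T3Family) (n K : ℕ)
    (U₀ : GaugeField (F.P K) 0 (Matrix.specialUnitaryGroup (Fin 2) ℂ)) {ε : ℝ} (hε : 0 < ε) (hεL : 1000000 * (F.L : ℝ) ^ 5 * ε ≤ 1)
    (hU : ∀ p : Plaq (F.P K) 0, dist1 (GaugeField.plaqHol U₀ p) ≤ ε * (((F.L : ℝ) ^ (K - n)) ^ 2)⁻¹)
    (Y : PBond (F.P K) 0 → Matrix (Fin 2) (Fin 2) ℂ)
    (G S : (k : ℕ) → PBond (F.P K) k → Matrix (Fin 2) (Fin 2) ℂ) (Λ : (k : ℕ) → Site (F.P K) k → Matrix (Fin 2) (Fin 2) ℂ)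
    (hΛ0 : ∀ x, Λ 0 x = 0) (hG0 : ∀ b, G 0 b = Y b) (hS0 : ∀ b, S 0 b = Y b)
    (hΛs : ∀ (k : ℕ) (z : Site (F.P K) (k + 1)), Λ (k + 1) z
      = (((Fintype.card (Idx (F.P K)) : ℂ))⁻¹ • ∑ i : Idx (F.P K),
              covWalkSum (Averaging.iter (fun i => blockAvg (P := (F.P K)) (j := i) (expMeanLogSU (n := Fin 2))) k U₀) (G k) (walk (emb z) (stairWord i.2.1 (off i.1))))
        + Λ k (emb z))
    (hGs : ∀ (k : ℕ) (c : PBond (F.P K) (k + 1)), G (k + 1) c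
      = (fderiv ℂ (eml : (Idx (F.P K) → Matrix (Fin 2) (Fin 2) ℂ) → Matrix (Fin 2) (Fin 2) ℂ)
            (fun i => ((loopHol (Averaging.iter (fun i => blockAvg (P := (F.P K)) (j := i) (expMeanLogSU (n := Fin 2))) k U₀) c i : Matrix.specialUnitaryGroup (Fin 2) ℂ) : Matrix (Fin 2) (Fin 2) ℂ))
            (fun i => covWalkSum (Averaging.iter (fun i => blockAvg (P := (F.P K)) (j := i) (expMeanLogSU (n := Fin 2))) k U₀) (G k) (walk (emb c.src) (loopWord (F.P K).L c.dir (off i.1) i.2.1 i.2.2))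
              * ((loopHol (Averaging.iter (fun i => blockAvg (P := (F.P K)) (j := i) (expMeanLogSU (n := Fin 2))) k U₀) c i : Matrix.specialUnitaryGroup (Fin 2) ℂ) : Matrix (Fin 2) (Fin 2) ℂ))
            * star ((corr (expMeanLogSU (n := Fin 2)) (Averaging.iter (fun i => blockAvg (P := (F.P K)) (j := i) (expMeanLogSU (n := Fin 2))) k U₀) c : Matrix.specialUnitaryGroup (Fin 2) ℂ) : Matrix (Fin 2) (Fin 2) ℂ)
          + ((corr (expMeanLogSU (n := Fin 2)) (Averaging.iter (fun i => blockAvg (P := (F.P K)) (j := i) (expMeanLogSU (n := Fin 2))) k U₀) c : Matrix.specialUnitaryGroup (Fin 2) ℂ) : Matrix (Fin 2) (Fin 2) ℂ)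
            * covWalkSum (Averaging.iter (fun i => blockAvg (P := (F.P K)) (j := i) (expMeanLogSU (n := Fin 2))) k U₀) (G k) (walk (emb c.src) (List.replicate (F.P K).L (c.dir, true)))
            * star ((corr (expMeanLogSU (n := Fin 2)) (Averaging.iter (fun i => blockAvg (P := (F.P K)) (j := i) (expMeanLogSU (n := Fin 2))) k U₀) c : Matrix.specialUnitaryGroup (Fin 2) ℂ) : Matrix (Fin 2) (Fin 2) ℂ))
        - ((((Fintype.card (Idx (F.P K)) : ℂ))⁻¹ • ∑ i : Idx (F.P K),
              covWalkSum (Averaging.iter (fun i => blockAvg (P := (F.P K)) (j := i) (expMeanLogSU (n := Fin 2))) k U₀) (G k) (walk (emb c.src) (stairWord i.2.1 (off i.1))))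
            - ((Averaging.iter (fun i => blockAvg (P := (F.P K)) (j := i) (expMeanLogSU (n := Fin 2))) (k + 1) U₀ c : Matrix.specialUnitaryGroup (Fin 2) ℂ) : Matrix (Fin 2) (Fin 2) ℂ)
              * (((Fintype.card (Idx (F.P K)) : ℂ))⁻¹ • ∑ i : Idx (F.P K),
              covWalkSum (Averaging.iter (fun i => blockAvg (P := (F.P K)) (j := i) (expMeanLogSU (n := Fin 2))) k U₀) (G k) (walk (emb c.tgt) (stairWord i.2.1 (off i.1))))
              * star ((Averaging.iter (fun i => blockAvg (P := (F.P K)) (j := i) (expMeanLogSU (n := Fin 2))) (k + 1) U₀ c : Matrix.specialUnitaryGroup (Fin 2) ℂ) : Matrix (Fin 2) (Fin 2) ℂ)))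
    (hSs : ∀ (k : ℕ) (c : PBond (F.P K) (k + 1)), S (k + 1) c
      = ((Fintype.card (Idx (F.P K)) : ℂ))⁻¹ • ∑ i : Idx (F.P K),
          ((holAt (Averaging.iter (fun i => blockAvg (P := (F.P K)) (j := i) (expMeanLogSU (n := Fin 2))) k U₀) (walk (emb c.src) (stairWord i.2.1 (off i.1))) : Matrix.specialUnitaryGroup (Fin 2) ℂ) : Matrix (Fin 2) (Fin 2) ℂ) *
            covWalkSum (Averaging.iter (fun i => blockAvg (P := (F.P K)) (j := i) (expMeanLogSU (n := Fin 2))) k U₀) (S k)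
              (walk (walkEnd (emb c.src) (stairWord i.2.1 (off i.1))) (List.replicate (F.P K).L (c.dir, true))) *
          star ((holAt (Averaging.iter (fun i => blockAvg (P := (F.P K)) (j := i) (expMeanLogSU (n := Fin 2))) k U₀) (walk (emb c.src) (stairWord i.2.1 (off i.1))) : Matrix.specialUnitaryGroup (Fin 2) ℂ) : Matrix (Fin 2) (Fin 2) ℂ)) :
    ∀ i ≤ K - n, ∑ y : Site (F.P K) i, ‖Λ i y‖ ^ 2 ≤ (F.L : ℝ) ^ i * (200 * (F.L : ℝ) ^ 4 * ((∑ x : Site (F.P K) 0, ∑ μ : Fin (F.P K).d, ∑ ν : Fin (F.P K).d,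
            (if μ < ν then ∑ j : Fin 2, ∑ k : Fin 2,
              ‖(curl (torusT (F.P K) 0) (fun κ z => unitsField (toUField U₀) ⟨z, κ⟩) (fun κ z => Y ⟨z, κ⟩) μ ν x) j k‖ ^ 2 else 0)) + (∑ x : Site (F.P K) 0, ∑ j : Fin 2, ∑ k : Fin 2,
            ‖(divB (torusT (F.P K) 0) (fun κ z => unitsField (toUField U₀) ⟨z, κ⟩) (fun κ z => Y ⟨z, κ⟩) x) j k‖ ^ 2)) + 4 * 10 ^ 9 * (F.L : ℝ) ^ 9 * ε * (((F.L : ℝ) ^ (K - n)) ^ 2)⁻¹ * (∑ b : PBond (F.P K) 0, ‖Y b‖ ^ 2)) := by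
  intro i hi
  have hL3 := three_le_L F
  have hL1 : (1 : ℝ) ≤ (F.L : ℝ) := by linarith
  obtain ⟨n', rfl⟩ : ∃ n', i = K - n' := ⟨K - i, by omega⟩
  have hApos : 0 < ((F.L : ℝ) ^ (K - n')) ^ 2 := by positivity
  have hBpos : 0 < ((F.L : ℝ) ^ (K - n)) ^ 2 := by positivity
  have hpow : ((F.L : ℝ) ^ (K - n')) ^ 2 ≤ ((F.L : ℝ) ^ (K - n)) ^ 2 :=
    pow_le_pow_left₀ (by positivity) (pow_le_pow_right₀ hL1 hi) 2
  -- the level-`i` size `ε′ := ε·L^{2i}·ℓ⁻²`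
  have hε' : 0 < ε * ((F.L : ℝ) ^ (K - n')) ^ 2 * (((F.L : ℝ) ^ (K - n)) ^ 2)⁻¹ := by positivity
  have hε'le : ε * ((F.L : ℝ) ^ (K - n')) ^ 2 * (((F.L : ℝ) ^ (K - n)) ^ 2)⁻¹ ≤ ε := by
    rw [mul_inv_le_iff₀ hBpos]
    exact mul_le_mul_of_nonneg_left hpow hε.le
  have hεL' : 1000000 * (F.L : ℝ) ^ 5 * (ε * ((F.L : ℝ) ^ (K - n')) ^ 2 * (((F.L : ℝ) ^ (K - n)) ^ 2)⁻¹) ≤ 1 :=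
    (mul_le_mul_of_nonneg_left hε'le (by positivity)).trans hεL
  have hA0 := hApos.ne'
  have hB0 := hBpos.ne'
  have hkey : ε * ((F.L : ℝ) ^ (K - n')) ^ 2 * (((F.L : ℝ) ^ (K - n)) ^ 2)⁻¹ * (((F.L : ℝ) ^ (K - n')) ^ 2)⁻¹ = ε * (((F.L : ℝ) ^ (K - n)) ^ 2)⁻¹ := by
    field_simp
  have hU' : ∀ p : Plaq (F.P K) 0, dist1 (GaugeField.plaqHol U₀ p)
      ≤ ε * ((F.L : ℝ) ^ (K - n')) ^ 2 * (((F.L : ℝ) ^ (K - n)) ^ 2)⁻¹ * (((F.L : ℝ) ^ (K - n')) ^ 2)⁻¹ :=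
    fun p => (hU p).trans (le_of_eq hkey.symm)
  have h := sum_normSq_covIterLambda_le_curl_T3_su2 F n' K U₀ hε' hεL' hU' Y G S Λ hΛ0 hG0 hS0 hΛs hGs hSs
  refine h.trans (le_of_eq ?_)
  push_cast
  field_simp
  ring

end Summit.QuantumFields.YangMills.Theorems.Prop7FibreLevelMassT3Letters

end
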